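import Mathlib
import HarnessLib
import Summits.HubbardSuperconductivity.HubbardSuperconductivity.Theorems.WeakCouplingBCSKlAllOrdersSelection
import Summits.HubbardSuperconductivity.HubbardSuperconductivity.Theorems.WeakCouplingBCSKlThirdOrderSelectionInf

/-!
# Route `WeakCouplingBCS` — channel-margin lane of `WcbcsKohnLuttingerB1g` (stmt-HubbardSuperconductivity-0158):
# GENERIC window-of-rows selection theorems (resummed chains, all orders, channel bottoms)

`Theorems/WeakCouplingBCSKlThirdOrderSelectionWindow.lean` proves the THIRD-ORDER window statement generically
(`klThirdOrder_selection_windowRows`: any list of `KLU0WinRow`s passing `klU0WinCheck`, joined by `klThirdOrderWindowJoin` to any list of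
second-order window records passing `checkB1gD` with their `EnclosuresB1g`, plus the named window hypotheses), but its three companions —
chains RESUMMED (`klResummed_selection_window`, `Theorems/WeakCouplingBCSDefsKlThirdOrderChains.lean`), ALL ORDERS with the rows' `C4`
(`klAllOrders_selection_window`, `Theorems/WeakCouplingBCSKlAllOrdersSelectionWindow.lean`) and the CHANNEL-BOTTOM forms
(`klThirdOrder_lt_channelInf3_window`, `klThirdOrder_channelInf3_lt_window`, `Theorems/WeakCouplingBCSKlThirdOrderSelectionInf.lean`) — were
written for the one instance `klU0WindowRows` × `klCertB1gWin{A,B,C}` (`μ ∈ [-0.42749, -0.1775]`).  This file states and proves the four of them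
for ARBITRARY `rows recs mub mua u` (same proofs, the instance facts become hypotheses), so that further windows of the lane — the
`δ ≈ 0.20` cell record `klCertB1gD020Cell`, the extension `klCertB1gWin{Z,Y,X}` towards `δ = 0.30`, and their joins — are one-line instances:
* `klResummed_selection_windowRows`;
* `klAllOrders_selection_windowRows` (the rows' common constants `C4`, `U1` enter through the kernel-decidable side condition
  `rows.all (fun w => w.row.C4 = C4 ∧ w.row.U1 = U1)`);
* `klThirdOrder_lt_channelInf3_windowRows`, `klThirdOrder_channelInf3_lt_windowRows`.
No numbers, no new definitions; nothing here asserts superconductivity.  Cell file: U0-TABLE.md v4 (gate-hubbard-kl, margin-1 g9).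

References: D. J. Scalapino, E. Loh, J. E. Hirsch, Phys. Rev. B 34 (1986) 8190, (3)–(4); S. Raghu, S. A. Kivelson, D. J. Scalapino,
Phys. Rev. B 81 (2010) 224505, App. A.
-/

noncomputable section

-- the tree's namespace `Summit.<Summit>.<Problem>.Theorems` repeats the summit name by design (D-0017)
set_option linter.dupNamespace false

namespace Summit.HubbardSuperconductivity.HubbardSuperconductivity.Theorems

open MeasureTheory Literature.MathematicalPhysics.QuantumLattice CwKLChiralWindow KlThirdOrder
open Summit.HubbardSuperconductivity.HubbardSuperconductivity.Theses.WeakCouplingBCS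

/-- **Window cover ⇒ the data at `μ`** (bookkeeping shared by the four theorems below): from the window checker, the join and the
records' checks/enclosures, every `μ ∈ [mub, mua]` gets a row `w` (with `w.row.ok`, `u ≤ w.row.U0`, box of `w` ∋ `μ`), a record `c ∈ recs`
and a box `bx ∈ c.boxes` containing the row's box (hence `μ`), with `bx.basicOKB1gD c.trials`, `w.row.dominates bx c.trials`,
`μ ∈ (-4, 0)`, and the record's enclosures read at `μ`. [folklore] -/
theorem klWindowRows_data (rows : List KLU0WinRow) (recs : List KLCert) (mub mua u : ℚ)
    (hcheck : klU0WinCheck mub mua u rows = true) (hjoin : klThirdOrderWindowJoin rows recs = true)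
    (hrec : ∀ c ∈ recs, c.checkB1gD = true ∧ c.EnclosuresB1g)
    (μ : ℝ) (hμ₁ : ((mub : ℚ) : ℝ) ≤ μ) (hμ₂ : μ ≤ ((mua : ℚ) : ℝ)) :
    ∃ w ∈ rows, ∃ c ∈ recs, ∃ bx ∈ c.boxes,
      ((w.mulo : ℚ) : ℝ) ≤ μ ∧ μ ≤ ((w.muhi : ℚ) : ℝ) ∧ w.row.ok = true ∧ u ≤ w.row.U0 ∧
      bx.mulo ≤ w.mulo ∧ w.muhi ≤ bx.muhi ∧ w.row.dominates bx c.trials = true ∧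
      bx.basicOKB1gD c.trials = true ∧ μ ∈ Set.Ioo (-4 : ℝ) 0 ∧
      bx.bB1g.RitzEnclosure c.trials μ ∧ (∀ χ : D4Irrep, χ ≠ D4Irrep.B1g → (bx.blk χ).Enclosure c.trials μ χ) := by
  obtain ⟨-, hcov⟩ := klU0Win_cover mub mua u rows hcheck
  obtain ⟨w, hw, hlo, hhi, hok, hu⟩ := hcov μ hμ₁ hμ₂
  obtain ⟨c, hc, bx, hbx, hcl, hch, hdom⟩ := klThirdOrderWindowJoin_spec rows recs hjoin w hw
  obtain ⟨hcheckc, hEc⟩ := hrec c hc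
  obtain ⟨-, hboxes, -⟩ := klb1gd_coverLogic c hcheckc
  obtain ⟨hBx, -⟩ := hboxes bx hbx
  have hB' := hBx
  simp only [KLBox.basicOKB1gD, Bool.and_eq_true, decide_eq_true_eq] at hB'
  obtain ⟨⟨⟨⟨⟨⟨⟨h4, -⟩, h0⟩, -⟩, -⟩, -⟩, -⟩, -⟩ := hB'
  have hlo' : ((bx.mulo : ℚ) : ℝ) ≤ μ := le_trans (by exact_mod_cast hcl) hlo
  have hhi' : μ ≤ ((bx.muhi : ℚ) : ℝ) := le_trans hhi (by exact_mod_cast hch)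
  have hμ : μ ∈ Set.Ioo (-4 : ℝ) 0 :=
    ⟨lt_of_lt_of_le (by exact_mod_cast h4) hlo', lt_of_le_of_lt hhi' (by exact_mod_cast h0)⟩
  obtain ⟨hER, hEχ⟩ := hEc bx hbx μ ⟨hlo', hhi'⟩
  exact ⟨w, hw, c, hc, bx, hbx, hlo, hhi, hok, hu, hcl, hch, hdom, hBx, hμ, hER, hEχ⟩

/-- **`B1g` selection with the chains RESUMMED on a window of rows** (generic `klResummed_selection_window`): rows passing
`klU0WinCheck mub mua u`, joined to records passing `checkB1gD` with their `EnclosuresB1g`, and the named window hypotheses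
`KlResummedWindowEnclosures rows recs` ⟹ for every `μ ∈ [mub, mua]` some `B1g` channel state on `F_μ` lies strictly below every normalised
`A1g/A2g/B2g/E` state of `resummedForm ε₀ μ U`, for all `0 < U ≤ u`. [cite: ScalapinoLohHirsch1986, (3)-(4)] -/
theorem klResummed_selection_windowRows (rows : List KLU0WinRow) (recs : List KLCert) (mub mua u : ℚ)
    (hcheck : klU0WinCheck mub mua u rows = true) (hjoin : klThirdOrderWindowJoin rows recs = true)
    (hrec : ∀ c ∈ recs, c.checkB1gD = true ∧ c.EnclosuresB1g)
    (h3 : KlResummedWindowEnclosures rows recs) :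
    ∀ μ : ℝ, ((mub : ℚ) : ℝ) ≤ μ → μ ≤ ((mua : ℚ) : ℝ) →
      ∃ ψ : Momentum → ℝ, IsChannelState (squareDispersion 1 0) μ D4Irrep.B1g ψ ∧
        ∀ U : ℝ, 0 < U → U ≤ ((u : ℚ) : ℝ) → ∀ χ : D4Irrep, χ ≠ D4Irrep.B1g →
          ∀ φ : Momentum → ℝ, IsChannelState (squareDispersion 1 0) μ χ φ →
            resummedForm (squareDispersion 1 0) μ U ψ < resummedForm (squareDispersion 1 0) μ U φ := by
  intro μ hμ₁ hμ₂
  obtain ⟨w, hw, c, hc, bx, hbx, hlo, hhi, hok, hu, hcl, hch, hdom, hBx, hμ, hER, hEχ⟩ :=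
    klWindowRows_data rows recs mub mua u hcheck hjoin hrec μ hμ₁ hμ₂
  have h3w := h3 w hw c hc bx hbx hcl hch hdom μ hlo hhi
  obtain ⟨ψ, hψ, hsel⟩ := klResummed_selectionD hμ bx c.trials hBx hER hEχ w.row hok hdom h3w
  exact ⟨ψ, hψ, fun U hU hUu => hsel U hU (le_trans hUu (by exact_mod_cast hu))⟩

/-- The common constants of a row of a list all of whose rows carry `C4 = C4₀` and `U1 = U1₀` (kernel-decidable side condition), as real
equalities. [folklore] -/
theorem klWindowRows_consts (rows : List KLU0WinRow) (C4₀ U1₀ : ℚ)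
    (hconsts : (rows.all fun w => decide (w.row.C4 = C4₀) && decide (w.row.U1 = U1₀)) = true)
    (w : KLU0WinRow) (hw : w ∈ rows) :
    (w.row.C4 : ℝ) = ((C4₀ : ℚ) : ℝ) ∧ (w.row.U1 : ℝ) = ((U1₀ : ℚ) : ℝ) := by
  have h := List.all_eq_true.1 hconsts w hw
  simp only [Bool.and_eq_true, decide_eq_true_eq] at h
  obtain ⟨h1, h2⟩ := h
  exact ⟨by rw [h1], by rw [h2]⟩

/-- **`B1g` selection to ALL orders on a window of rows** (generic `klAllOrders_selection_window`): as in
`klResummed_selection_windowRows`, with every row carrying the same assumed non-chain constant `C4₀` and the same `U1₀`; then for EVERY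
coupling-dependent remainder kernel `R` whose form is `≤ C4₀‖Φ_B‖²` on the `B1g` trial of every record box at every `μ` of that box and
`≥ -C4₀` on normalised competitor states, for `0 < U ≤ U1₀`, the `B1g` state lies strictly below every normalised `A1g/A2g/B2g/E` state in the
full form `resummedForm + U²⟨·, R U ·⟩`, for every `μ ∈ [mub, mua]` and all `0 < U ≤ u`.  `C4₀` is ASSUMED (no fourth-order non-chain
diagram is bounded here). [cite: RaghuKivelsonScalapino2010, App. A] -/
theorem klAllOrders_selection_windowRows (rows : List KLU0WinRow) (recs : List KLCert) (mub mua u C4₀ U1₀ : ℚ)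
    (hcheck : klU0WinCheck mub mua u rows = true) (hjoin : klThirdOrderWindowJoin rows recs = true)
    (hrec : ∀ c ∈ recs, c.checkB1gD = true ∧ c.EnclosuresB1g)
    (h3 : KlResummedWindowEnclosures rows recs)
    (hconsts : (rows.all fun w => decide (w.row.C4 = C4₀) && decide (w.row.U1 = U1₀)) = true)
    (R : ℝ → Momentum → Momentum → ℝ)
    (hRB : ∀ c ∈ recs, ∀ bx ∈ c.boxes, ∀ μ : ℝ,
      ((bx.mulo : ℚ) : ℝ) ≤ μ → μ ≤ ((bx.muhi : ℚ) : ℝ) → ∀ U : ℝ, 0 < U → U ≤ ((U1₀ : ℚ) : ℝ) →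
        kform (fermiCurveMeasure (squareDispersion 1 0) μ) (R U) (bx.bB1g.trialFun c.trials) ≤
          ((C4₀ : ℚ) : ℝ) * ∫ k, bx.bB1g.trialFun c.trials k ^ 2 ∂fermiCurveMeasure (squareDispersion 1 0) μ)
    (hRχ : ∀ μ : ℝ, ((mub : ℚ) : ℝ) ≤ μ → μ ≤ ((mua : ℚ) : ℝ) →
      ∀ U : ℝ, 0 < U → U ≤ ((U1₀ : ℚ) : ℝ) → ∀ χ : D4Irrep, χ ≠ D4Irrep.B1g →
        ∀ φ : Momentum → ℝ, IsChannelState (squareDispersion 1 0) μ χ φ →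
          -((C4₀ : ℚ) : ℝ) ≤ kform (fermiCurveMeasure (squareDispersion 1 0) μ) (R U) φ) :
    ∀ μ : ℝ, ((mub : ℚ) : ℝ) ≤ μ → μ ≤ ((mua : ℚ) : ℝ) →
      ∃ ψ : Momentum → ℝ, IsChannelState (squareDispersion 1 0) μ D4Irrep.B1g ψ ∧
        ∀ U : ℝ, 0 < U → U ≤ ((u : ℚ) : ℝ) → ∀ χ : D4Irrep, χ ≠ D4Irrep.B1g →
          ∀ φ : Momentum → ℝ, IsChannelState (squareDispersion 1 0) μ χ φ →
            resummedForm (squareDispersion 1 0) μ U ψ + U ^ 2 * kform (fermiCurveMeasure (squareDispersion 1 0) μ) (R U) ψ <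
              resummedForm (squareDispersion 1 0) μ U φ + U ^ 2 * kform (fermiCurveMeasure (squareDispersion 1 0) μ) (R U) φ := by
  intro μ hμ₁ hμ₂
  obtain ⟨w, hw, c, hc, bx, hbx, hlo, hhi, hok, hu, hcl, hch, hdom, hBx, hμ, hER, hEχ⟩ :=
    klWindowRows_data rows recs mub mua u hcheck hjoin hrec μ hμ₁ hμ₂
  have h3w := h3 w hw c hc bx hbx hcl hch hdom μ hlo hhi
  obtain ⟨hC4, hU1⟩ := klWindowRows_consts rows C4₀ U1₀ hconsts w hw
  have hlo' : ((bx.mulo : ℚ) : ℝ) ≤ μ := le_trans (by exact_mod_cast hcl) hlo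
  have hhi' : μ ≤ ((bx.muhi : ℚ) : ℝ) := le_trans hhi (by exact_mod_cast hch)
  have hRBw : ∀ U : ℝ, 0 < U → U ≤ w.row.U1 →
      kform (fermiCurveMeasure (squareDispersion 1 0) μ) (R U) (bx.bB1g.trialFun c.trials) ≤
        (w.row.C4 : ℝ) * ∫ k, bx.bB1g.trialFun c.trials k ^ 2 ∂fermiCurveMeasure (squareDispersion 1 0) μ := by
    intro U hU hUU
    rw [hC4]
    exact hRB c hc bx hbx μ hlo' hhi' U hU (by rw [hU1] at hUU; exact hUU)
  have hRχw : ∀ U : ℝ, 0 < U → U ≤ w.row.U1 → ∀ χ : D4Irrep, χ ≠ D4Irrep.B1g →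
      ∀ φ : Momentum → ℝ, IsChannelState (squareDispersion 1 0) μ χ φ →
        -(w.row.C4 : ℝ) ≤ kform (fermiCurveMeasure (squareDispersion 1 0) μ) (R U) φ := by
    intro U hU hUU χ hχ φ hφ
    rw [hC4]
    exact hRχ μ hμ₁ hμ₂ U hU (by rw [hU1] at hUU; exact hUU) χ hχ φ hφ
  obtain ⟨ψ, hψ, hsel⟩ := klAllOrders_selectionD hμ bx c.trials hBx hER hEχ w.row hok hdom h3w R hRBw hRχw
  exact ⟨ψ, hψ, fun U hU hUu => hsel U hU (le_trans hUu (by exact_mod_cast hu))⟩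

/-- **`B1g` trial strictly below every competitor's third-order CHANNEL BOTTOM on a window of rows** (generic
`klThirdOrder_lt_channelInf3_window`): rows passing `klU0WinCheck mub mua u`, joined to records passing `checkB1gD` with their
`EnclosuresB1g`, and `KlThirdOrderWindowEnclosures rows recs` ⟹ for every `μ ∈ [mub, mua]`, every `0 < U ≤ u` and every `χ ≠ B1g` some
normalised `B1g` state on `F_μ` lies strictly below `channelInf3 ε₀ μ U χ`. [cite: RaghuKivelsonScalapino2010, App. A] -/
theorem klThirdOrder_lt_channelInf3_windowRows (rows : List KLU0WinRow) (recs : List KLCert) (mub mua u : ℚ)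
    (hcheck : klU0WinCheck mub mua u rows = true) (hjoin : klThirdOrderWindowJoin rows recs = true)
    (hrec : ∀ c ∈ recs, c.checkB1gD = true ∧ c.EnclosuresB1g)
    (h3 : KlThirdOrderWindowEnclosures rows recs) :
    ∀ μ : ℝ, ((mub : ℚ) : ℝ) ≤ μ → μ ≤ ((mua : ℚ) : ℝ) →
      ∃ ψ : Momentum → ℝ, IsChannelState (squareDispersion 1 0) μ D4Irrep.B1g ψ ∧
        ∀ U : ℝ, 0 < U → U ≤ ((u : ℚ) : ℝ) → ∀ χ : D4Irrep, χ ≠ D4Irrep.B1g →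
          thirdOrderForm (squareDispersion 1 0) μ U ψ < channelInf3 (squareDispersion 1 0) μ U χ := by
  intro μ hμ₁ hμ₂
  obtain ⟨w, hw, c, hc, bx, hbx, hlo, hhi, hok, hu, hcl, hch, hdom, hBx, hμ, hER, hEχ⟩ :=
    klWindowRows_data rows recs mub mua u hcheck hjoin hrec μ hμ₁ hμ₂
  have h3w := h3 w hw c hc bx hbx hcl hch hdom μ hlo hhi
  obtain ⟨hritz, hlower⟩ := klto_lower_of_basicOKB1gD hμ bx c.trials hBx hEχ
  obtain ⟨ψ, hψ, hsel⟩ := klThirdOrder_lt_channelInf3 hμ bx c.trials hritz hER hlower w.row hok hdom h3w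
  exact ⟨ψ, hψ, fun U hU hUu χ hχ => (hsel U hU (le_trans hUu (by exact_mod_cast hu)) χ hχ).1⟩

/-- **`B1g` has the strictly lowest third-order channel bottom on a window of rows** (generic `klThirdOrder_channelInf3_lt_window`): as in
`klThirdOrder_lt_channelInf3_windowRows`, plus, for each row, ONE `B1g`-valid lower bound of the `K₃`-form on its box, taken as the row's
`A2g` datum read on the `B1g` states (`(w.row.chanOf A2g).ThirdOrderLowerBound μ B1g`; for rows whose even-channel data are the
channel-independent Hilbert–Schmidt numbers `‖2x̄²‖_HS`, `‖N̄_V+N̄_P‖_HS` this is what the certificates deliver) ⟹ for every `μ ∈ [mub, mua]`,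
every `0 < U ≤ u` and every `χ ≠ B1g`: `channelInf3 ε₀ μ U B1g < channelInf3 ε₀ μ U χ`. [cite: RaghuKivelsonScalapino2010, App. A] -/
theorem klThirdOrder_channelInf3_lt_windowRows (rows : List KLU0WinRow) (recs : List KLCert) (mub mua u : ℚ)
    (hcheck : klU0WinCheck mub mua u rows = true) (hjoin : klThirdOrderWindowJoin rows recs = true)
    (hrec : ∀ c ∈ recs, c.checkB1gD = true ∧ c.EnclosuresB1g)
    (h3 : KlThirdOrderWindowEnclosures rows recs)
    (hB1g : ∀ w ∈ rows, ∀ μ : ℝ, ((w.mulo : ℚ) : ℝ) ≤ μ → μ ≤ ((w.muhi : ℚ) : ℝ) →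
      (w.row.chanOf D4Irrep.A2g).ThirdOrderLowerBound μ D4Irrep.B1g) :
    ∀ μ : ℝ, ((mub : ℚ) : ℝ) ≤ μ → μ ≤ ((mua : ℚ) : ℝ) →
      ∀ U : ℝ, 0 < U → U ≤ ((u : ℚ) : ℝ) → ∀ χ : D4Irrep, χ ≠ D4Irrep.B1g →
        channelInf3 (squareDispersion 1 0) μ U D4Irrep.B1g < channelInf3 (squareDispersion 1 0) μ U χ := by
  intro μ hμ₁ hμ₂
  obtain ⟨w, hw, c, hc, bx, hbx, hlo, hhi, hok, hu, hcl, hch, hdom, hBx, hμ, hER, hEχ⟩ :=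
    klWindowRows_data rows recs mub mua u hcheck hjoin hrec μ hμ₁ hμ₂
  have h3w := h3 w hw c hc bx hbx hcl hch hdom μ hlo hhi
  obtain ⟨hritz, hlower⟩ := klto_lower_of_basicOKB1gD hμ bx c.trials hBx hEχ
  intro U hU hUu χ hχ
  exact klThirdOrder_channelInf3_lt hμ bx c.trials hritz hER hlower w.row hok hdom h3w _ (hB1g w hw μ hlo hhi)
    U hU (le_trans hUu (by exact_mod_cast hu)) χ hχ

/-- **Sanity instance**: the generic resummed theorem reproduces the tree's `klResummed_selection_window` on `klU0WindowRows` ×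
`klCertB1gWin{A,B,C}` (`μ ∈ [-0.42749, -0.1775]`, `u = klU0WindowU`). [cite: ScalapinoLohHirsch1986, (3)-(4)] -/
theorem klResummed_selection_window' (hA : klCertB1gWinA.EnclosuresB1g) (hB : klCertB1gWinB.EnclosuresB1g)
    (hC : klCertB1gWinC.EnclosuresB1g)
    (h3 : KlResummedWindowEnclosures klU0WindowRows [klCertB1gWinA, klCertB1gWinB, klCertB1gWinC]) :
    ∀ μ : ℝ, ((((-42749 : ℚ) / 100000) : ℚ) : ℝ) ≤ μ → μ ≤ ((((-71 : ℚ) / 400) : ℚ) : ℝ) →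
      ∃ ψ : Momentum → ℝ, IsChannelState (squareDispersion 1 0) μ D4Irrep.B1g ψ ∧
        ∀ U : ℝ, 0 < U → U ≤ ((klU0WindowU : ℚ) : ℝ) → ∀ χ : D4Irrep, χ ≠ D4Irrep.B1g →
          ∀ φ : Momentum → ℝ, IsChannelState (squareDispersion 1 0) μ χ φ →
            resummedForm (squareDispersion 1 0) μ U ψ < resummedForm (squareDispersion 1 0) μ U φ :=
  klResummed_selection_windowRows _ _ _ _ _ klU0WindowRows_check klto_window_join (klto_window_recs hA hB hC) h3

end Summit.HubbardSuperconductivity.HubbardSuperconductivity.Theorems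

end
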